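import Mathlib
import HarnessLib
import Literature.Probability.MarkovChains.TotalVariation
import Literature.Probability.MarkovChains.LogSobolevConstant
import Literature.Probability.Entropy.BinaryRelativeEntropy

/-!
# Data processing and joint convexity of KL and total variation under finite channels

[cite: PolyanskiyWu2024, Thm 2.17 (eq. (2.28)); Cor 2.18; Thm 5.1; Thm 7.4; Thm 7.5(b)]

A finite CHANNEL from `X` to `Y` is a row-stochastic array `K : X → Y → ℝ` (`K x · ≥ 0` of mass one);
it pushes a law `μ` on `X` to `μK(y) = Σ_x μ(x)K(x,y)` on `Y` (for `Y = X` this is the tree's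
`stepLaw K μ` of `MarkovChains/TotalVariation.lean`; a deterministic map `f : X → Y` is the channel
`K(x,y) = 1{f(x) = y}`, pushing `μ` to its image law `y ↦ Σ_{f(x)=y} μ(x)` — coarse-graining).  With
`D = relEnt` (`Σ_x m(x) log(m(x)/π(x))`, natural logarithm, `MarkovChains/LogSobolevConstant.lean`) and
`TV = tvDist` this file PROVES (finite sums, 0 named facts, no new definition):

* **DPI for KL** `PolyanskiyWu2024_thm_2_17` — "Let `P_Y = P_{Y|X} ∘ P_X` and `Q_Y = P_{Y|X} ∘ Q_X` … Then
  `D(P_Y ‖ Q_Y) ≤ D(P_X ‖ Q_X)`" [cite: PolyanskiyWu2024, Thm 2.17 (eq. (2.28))], proved as the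
  log-sum inequality (the tree's `sum_mul_log_div_le`) on the support of each column of `K`;
  square case `relEnt_stepLaw_le`; **divergence under a deterministic transformation**
  `PolyanskiyWu2024_cor_2_18` ("Let `Y = f(X)`. Then `D(P_Y ‖ Q_Y) ≤ D(P_X ‖ Q_X)`")
  [cite: PolyanskiyWu2024, Cor 2.18] (its event case, Cor 2.19, is the tree's
  `binaryKL_le_sum_mul_log_div`);
* **joint convexity of KL** `PolyanskiyWu2024_thm_5_1` — "The map `(P,Q) ↦ D(P‖Q)` is convex"
  [cite: PolyanskiyWu2024, Thm 5.1], for finite mixtures `Σ_i w_i μ_i` versus `Σ_i w_i ν_i`, `w ≥ 0`;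
* **DPI for TV** `PolyanskiyWu2024_thm_7_4_tv` (`TV(μK, νK) ≤ TV(μ, ν)`, any channel — the tree's
  `tvDist_stepLaw_le` is the square case) [cite: PolyanskiyWu2024, Thm 7.4 (TV is the `f`-divergence
  `f(x) = ½|x − 1|`)], image-law case `tvDist_map_le`, and **joint convexity of TV**
  `PolyanskiyWu2024_thm_7_5_b_tv` [cite: PolyanskiyWu2024, Thm 7.5(b)].

Hypotheses: for KL the reference laws are strictly positive (`ν > 0`, `ν_i > 0`) and the compared laws
non-negative, as in `PinskerInequality.lean`; for TV nothing beyond the channel being row-stochastic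
(respectively `w ≥ 0`).  Context (cell pub-lqcd, venture LatticeQCDFlow): every figure of merit that is
a KL or TV between a sampler's law and its target can only DECREASE under blocking / coarse-graining /
one more exact update, and is convex under mixing of proposals.
-/

namespace Literature.Probability.Entropy

open Finset Real
open Literature.Probability.MarkovChains

variable {X Y : Type*} [Fintype X] [Fintype Y]

/-! ## KL divergence: data processing (Thm 2.17) -/

/-- **Data-processing inequality for the KL divergence** [cite: PolyanskiyWu2024, Thm 2.17
(eq. (2.28))]: for a channel `K` (rows `K(x,·) ≥ 0` of mass one) and laws `μ ≥ 0`, `ν > 0` on `X`,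
`D(μK ‖ νK) ≤ D(μ ‖ ν)`.  Proof: `Σ_x μ log(μ/ν) = Σ_y Σ_x (μK)(x,y) log((μK)(x,y)/(νK)(x,y))` and the
log-sum inequality in `x` for each `y`. -/
theorem PolyanskiyWu2024_thm_2_17 (K : X → Y → ℝ) (hK0 : ∀ x y, 0 ≤ K x y)
    (hK1 : ∀ x, ∑ y, K x y = 1) {μ ν : X → ℝ} (hμ : ∀ x, 0 ≤ μ x) (hν : ∀ x, 0 < ν x) :
    relEnt (fun y => ∑ x, μ x * K x y) (fun y => ∑ x, ν x * K x y) ≤ relEnt μ ν := by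
  classical
  unfold relEnt
  -- pointwise cancellation of `K(x,y)` inside the logarithm (both sides vanish when `K(x,y) = 0`)
  have hpt : ∀ x y, μ x * K x y * Real.log (μ x / ν x)
      = μ x * K x y * Real.log (μ x * K x y / (ν x * K x y)) := by
    intro x y
    rcases (hK0 x y).eq_or_lt with h0 | hpos
    · rw [← h0]
      simp
    · rw [mul_div_mul_right _ _ hpos.ne']
  have hR : ∑ x, μ x * Real.log (μ x / ν x)
      = ∑ y, ∑ x, μ x * K x y * Real.log (μ x * K x y / (ν x * K x y)) := by
    rw [sum_comm]
    refine sum_congr rfl fun x _ => ?_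
    calc μ x * Real.log (μ x / ν x) = (∑ y, μ x * K x y) * Real.log (μ x / ν x) := by
          rw [← mul_sum, hK1 x, mul_one]
      _ = ∑ y, μ x * K x y * Real.log (μ x * K x y / (ν x * K x y)) := by
          rw [sum_mul]
          exact sum_congr rfl fun y _ => hpt x y
  rw [hR]
  refine sum_le_sum fun y _ => ?_
  beta_reduce
  -- the log-sum inequality on the support `s` of the column `K(·,y)`
  set s := univ.filter (fun x => 0 < K x y) with hs
  have hoff : ∀ x, x ∉ s → K x y = 0 := fun x hx => by
    by_contra hne
    exact hx (mem_filter.2 ⟨mem_univ x, lt_of_le_of_ne (hK0 x y) (Ne.symm hne)⟩)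
  have hA : ∑ x, μ x * K x y = ∑ x ∈ s, μ x * K x y :=
    (sum_subset (subset_univ s) fun x _ hx => by rw [hoff x hx, mul_zero]).symm
  have hB : ∑ x, ν x * K x y = ∑ x ∈ s, ν x * K x y :=
    (sum_subset (subset_univ s) fun x _ hx => by rw [hoff x hx, mul_zero]).symm
  have hC : ∑ x, μ x * K x y * Real.log (μ x * K x y / (ν x * K x y))
      = ∑ x ∈ s, μ x * K x y * Real.log (μ x * K x y / (ν x * K x y)) :=
    (sum_subset (subset_univ s) fun x _ hx => by rw [hoff x hx, mul_zero, zero_mul]).symm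
  rw [hA, hB, hC]
  exact sum_mul_log_div_le s (fun x => μ x * K x y) (fun x => ν x * K x y)
    (fun x _ => mul_nonneg (hμ x) (hK0 x y)) fun x hx => mul_pos (hν x) (mem_filter.1 hx).2

/-- The square case in the tree's vocabulary: `D(μP ‖ νP) ≤ D(μ ‖ ν)` for a row-stochastic `P`
(`stepLaw`).  (With `ν = π` stationary this is the monotonicity of `D(μPᵗ ‖ π)` in `t`, cf.
`LogSobolevConstant.lean`.) [cite: PolyanskiyWu2024, Thm 2.17 (eq. (2.28))] -/
theorem relEnt_stepLaw_le {P : X → X → ℝ} (hP : IsRowStochastic P) {μ ν : X → ℝ}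
    (hμ : ∀ x, 0 ≤ μ x) (hν : ∀ x, 0 < ν x) :
    relEnt (stepLaw P μ) (stepLaw P ν) ≤ relEnt μ ν :=
  PolyanskiyWu2024_thm_2_17 P hP.1 hP.2 hμ hν

/-- **Divergence under a deterministic transformation** [cite: PolyanskiyWu2024, Cor 2.18]: for
`f : X → Y` and the image laws `μ_f(y) = Σ_{f(x)=y} μ(x)`, `ν_f`, `D(μ_f ‖ ν_f) ≤ D(μ ‖ ν)`
(`μ ≥ 0`, `ν > 0`). -/
theorem PolyanskiyWu2024_cor_2_18 [DecidableEq Y] (f : X → Y) {μ ν : X → ℝ} (hμ : ∀ x, 0 ≤ μ x)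
    (hν : ∀ x, 0 < ν x) :
    relEnt (fun y => ∑ x ∈ univ.filter (fun x => f x = y), μ x)
        (fun y => ∑ x ∈ univ.filter (fun x => f x = y), ν x) ≤ relEnt μ ν := by
  have h := PolyanskiyWu2024_thm_2_17 (fun x y => if f x = y then (1 : ℝ) else 0)
    (fun x y => by split_ifs <;> norm_num) (fun x => by simp) hμ hν
  simp only [mul_ite, mul_one, mul_zero] at h
  simpa only [sum_filter] using h

/-! ## KL divergence: joint convexity (Thm 5.1) -/

/-- **Joint convexity of the KL divergence** [cite: PolyanskiyWu2024, Thm 5.1] ("The map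
`(P,Q) ↦ D(P‖Q)` is convex"), for finite mixtures: with weights `w_i ≥ 0`,
`D(Σ_i w_i μ_i ‖ Σ_i w_i ν_i) ≤ Σ_i w_i D(μ_i ‖ ν_i)` (`μ_i ≥ 0`, `ν_i > 0`).  Proof: the log-sum
inequality in `i` for each point `x`, on the support of `w`. -/
theorem PolyanskiyWu2024_thm_5_1 {I : Type*} [Fintype I] (w : I → ℝ) (hw : ∀ i, 0 ≤ w i)
    (μ ν : I → X → ℝ) (hμ : ∀ i x, 0 ≤ μ i x) (hν : ∀ i x, 0 < ν i x) :
    relEnt (fun x => ∑ i, w i * μ i x) (fun x => ∑ i, w i * ν i x)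
      ≤ ∑ i, w i * relEnt (μ i) (ν i) := by
  classical
  unfold relEnt
  -- right-hand side as `Σ_x Σ_i (w_i μ_i) log((w_i μ_i)/(w_i ν_i))`
  have hpt : ∀ i x, w i * (μ i x * Real.log (μ i x / ν i x))
      = w i * μ i x * Real.log (w i * μ i x / (w i * ν i x)) := by
    intro i x
    rcases (hw i).eq_or_lt with h0 | hpos
    · rw [← h0]
      simp
    · rw [mul_div_mul_left _ _ hpos.ne', mul_assoc]
  have hR : ∑ i, w i * ∑ x, μ i x * Real.log (μ i x / ν i x)
      = ∑ x, ∑ i, w i * μ i x * Real.log (w i * μ i x / (w i * ν i x)) := by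
    rw [sum_comm]
    refine sum_congr rfl fun i _ => ?_
    rw [mul_sum]
    exact sum_congr rfl fun x _ => hpt i x
  rw [hR]
  refine sum_le_sum fun x _ => ?_
  beta_reduce
  set s := univ.filter (fun i => 0 < w i) with hs
  have hoff : ∀ i, i ∉ s → w i = 0 := fun i hi => by
    by_contra hne
    exact hi (mem_filter.2 ⟨mem_univ i, lt_of_le_of_ne (hw i) (Ne.symm hne)⟩)
  have hA : ∑ i, w i * μ i x = ∑ i ∈ s, w i * μ i x :=
    (sum_subset (subset_univ s) fun i _ hi => by rw [hoff i hi, zero_mul]).symm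
  have hB : ∑ i, w i * ν i x = ∑ i ∈ s, w i * ν i x :=
    (sum_subset (subset_univ s) fun i _ hi => by rw [hoff i hi, zero_mul]).symm
  have hC : ∑ i, w i * μ i x * Real.log (w i * μ i x / (w i * ν i x))
      = ∑ i ∈ s, w i * μ i x * Real.log (w i * μ i x / (w i * ν i x)) :=
    (sum_subset (subset_univ s) fun i _ hi => by rw [hoff i hi, zero_mul, zero_mul]).symm
  rw [hA, hB, hC]
  exact sum_mul_log_div_le s (fun i => w i * μ i x) (fun i => w i * ν i x)
    (fun i _ => mul_nonneg (hw i) (hμ i x)) fun i hi => mul_pos (mem_filter.1 hi).2 (hν i x)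

/-- Two-point form: `D(λP₁ + (1−λ)P₀ ‖ λQ₁ + (1−λ)Q₀) ≤ λ D(P₁‖Q₁) + (1−λ) D(P₀‖Q₀)` for
`λ ∈ [0,1]`. [cite: PolyanskiyWu2024, Thm 5.1] -/
theorem PolyanskiyWu2024_thm_5_1_two {P₁ P₀ Q₁ Q₀ : X → ℝ} (hP₁ : ∀ x, 0 ≤ P₁ x)
    (hP₀ : ∀ x, 0 ≤ P₀ x) (hQ₁ : ∀ x, 0 < Q₁ x) (hQ₀ : ∀ x, 0 < Q₀ x) {t : ℝ} (ht0 : 0 ≤ t)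
    (ht1 : t ≤ 1) :
    relEnt (fun x => t * P₁ x + (1 - t) * P₀ x) (fun x => t * Q₁ x + (1 - t) * Q₀ x)
      ≤ t * relEnt P₁ Q₁ + (1 - t) * relEnt P₀ Q₀ := by
  have h := PolyanskiyWu2024_thm_5_1 (X := X) (I := Fin 2) ![t, 1 - t]
    (fun i => by fin_cases i <;> simp [ht0, ht1]) ![P₁, P₀] ![Q₁, Q₀]
    (fun i x => by fin_cases i <;> simp [hP₁ x, hP₀ x]) fun i x => by fin_cases i <;> simp [hQ₁ x, hQ₀ x]
  simpa [Fin.sum_univ_two] using h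

/-! ## Total variation: data processing (Thm 7.4) and joint convexity (Thm 7.5(b)) -/

omit [Fintype Y] in
/-- `|Σ_x (μ − ν)(x) K(x,y)| ≤ Σ_x |μ(x) − ν(x)| K(x,y)` for `K(·,y) ≥ 0`. [cite: PolyanskiyWu2024,
Thm 7.4 (proof pattern: convexity of `|·|`)] -/
theorem abs_sum_mul_sub_sum_mul_le (K : X → Y → ℝ) (hK0 : ∀ x y, 0 ≤ K x y) (μ ν : X → ℝ) (y : Y) :
    |∑ x, μ x * K x y - ∑ x, ν x * K x y| ≤ ∑ x, |μ x - ν x| * K x y := by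
  rw [← sum_sub_distrib]
  refine (abs_sum_le_sum_abs _ _).trans (le_of_eq (sum_congr rfl fun x _ => ?_))
  rw [← sub_mul, abs_mul, abs_of_nonneg (hK0 x y)]

/-- **Data-processing inequality for total variation** [cite: PolyanskiyWu2024, Thm 7.4 (`TV` is the
`f`-divergence with `f(x) = ½|x − 1|`)]: `TV(μK, νK) ≤ TV(μ, ν)` for any channel `K` and any two
vectors `μ, ν` (the square case is `tvDist_stepLaw_le`). -/
theorem PolyanskiyWu2024_thm_7_4_tv (K : X → Y → ℝ) (hK0 : ∀ x y, 0 ≤ K x y)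
    (hK1 : ∀ x, ∑ y, K x y = 1) (μ ν : X → ℝ) :
    tvDist (fun y => ∑ x, μ x * K x y) (fun y => ∑ x, ν x * K x y) ≤ tvDist μ ν := by
  unfold tvDist
  have key : ∑ y, |∑ x, μ x * K x y - ∑ x, ν x * K x y| ≤ ∑ x, |μ x - ν x| :=
    calc ∑ y, |∑ x, μ x * K x y - ∑ x, ν x * K x y|
        ≤ ∑ y, ∑ x, |μ x - ν x| * K x y := sum_le_sum fun y _ => abs_sum_mul_sub_sum_mul_le K hK0 μ ν y
      _ = ∑ x, |μ x - ν x| := by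
          rw [sum_comm]
          exact sum_congr rfl fun x _ => by rw [← mul_sum, hK1 x, mul_one]
  linarith

/-- **TV under a deterministic transformation** (coarse-graining): for `f : X → Y` and the image laws,
`TV(μ_f, ν_f) ≤ TV(μ, ν)`. [cite: PolyanskiyWu2024, Thm 7.4 (with Cor 2.18's channel `1{f(x) = y}`)] -/
theorem tvDist_map_le [DecidableEq Y] (f : X → Y) (μ ν : X → ℝ) :
    tvDist (fun y => ∑ x ∈ univ.filter (fun x => f x = y), μ x)
        (fun y => ∑ x ∈ univ.filter (fun x => f x = y), ν x) ≤ tvDist μ ν := by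
  have h := PolyanskiyWu2024_thm_7_4_tv (fun x y => if f x = y then (1 : ℝ) else 0)
    (fun x y => by split_ifs <;> norm_num) (fun x => by simp) μ ν
  simp only [mul_ite, mul_one, mul_zero] at h
  simpa only [sum_filter] using h

/-- **Joint convexity of total variation** [cite: PolyanskiyWu2024, Thm 7.5(b)]: with weights
`w_i ≥ 0`, `TV(Σ_i w_i μ_i, Σ_i w_i ν_i) ≤ Σ_i w_i TV(μ_i, ν_i)`. -/
theorem PolyanskiyWu2024_thm_7_5_b_tv {I : Type*} [Fintype I] (w : I → ℝ) (hw : ∀ i, 0 ≤ w i)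
    (μ ν : I → X → ℝ) :
    tvDist (fun x => ∑ i, w i * μ i x) (fun x => ∑ i, w i * ν i x)
      ≤ ∑ i, w i * tvDist (μ i) (ν i) := by
  unfold tvDist
  have key : ∑ x, |∑ i, w i * μ i x - ∑ i, w i * ν i x| ≤ ∑ i, w i * ∑ x, |μ i x - ν i x| :=
    calc ∑ x, |∑ i, w i * μ i x - ∑ i, w i * ν i x|
        ≤ ∑ x, ∑ i, w i * |μ i x - ν i x| := by
          refine sum_le_sum fun x _ => ?_
          rw [← sum_sub_distrib]
          refine (abs_sum_le_sum_abs _ _).trans (le_of_eq (sum_congr rfl fun i _ => ?_))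
          rw [← mul_sub, abs_mul, abs_of_nonneg (hw i)]
      _ = ∑ i, w i * ∑ x, |μ i x - ν i x| := by
          rw [sum_comm]
          exact sum_congr rfl fun i _ => by rw [mul_sum]
  have e : ∑ i, w i * ((1 / 2) * ∑ x, |μ i x - ν i x|) = (1 / 2) * ∑ i, w i * ∑ x, |μ i x - ν i x| := by
    rw [mul_sum]
    exact sum_congr rfl fun i _ => by ring
  rw [e]
  linarith

end Literature.Probability.Entropy
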